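import Summits.CriticalPhenomena.PercolationContinuityZ3.Theorems.Transplant.FKDoubleFanMixedConeInvA
import Summits.CriticalPhenomena.PercolationContinuityZ3.Theorems.Transplant.FKDoubleFanMixedConeInvB
import Summits.CriticalPhenomena.PercolationContinuityZ3.Theorems.Transplant.FKDoubleFanMixedConeInvC
import Summits.CriticalPhenomena.PercolationContinuityZ3.Theorems.Transplant.FKDoubleFanMixedConeInvD
import Summits.CriticalPhenomena.PercolationContinuityZ3.Theorems.Transplant.FKDoubleFanSameTwoB
import Summits.CriticalPhenomena.PercolationContinuityZ3.Theorems.Transplant.FKDoubleFanNegCorrAdjacent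
import HarnessLib

/-!
# Double fans `K₂ ∨ P_{m+1}`: ANY TWO SPOKES OF THE SAME APEX ARE NEGATIVELY CORRELATED (`0 < q ≤ 1`)

Support file (`--supports stmt-CriticalPhenomena-4575`), FK sub-lane `prim-bschramm-fk-3` (gen 24); builds on p205010 (kernel theorem, internal
audit signed; external expert review pending).  No named facts, no sorries; standard axioms.  Memos `bschramm/prim-bschramm-fk-3/ALL-SAME-APEX.md`
(the certificate) and `SAME-APEX-LEAN.md` (this formalisation).

THEOREM.  For two distinct apices `a, b` and rim vertices `c 0, …, c m` (pairwise distinct, not apices) exhausting `V` (`card V = m + 3`), every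
weight vector `w` supported on the double fan, every `0 < q ≤ 1` and all `i < k ≤ m`:
**`negCorr_spokesA_sameApex`**: `φ_{w,q}(J_{a c_i} ∩ J_{a c_k}) ≤ φ_{w,q}(J_{a c_i})·φ_{w,q}(J_{a c_k})` (and **`negCorr_spokesB_sameApex`**).
This contains the adjacent pair (gen 20) and the distance-two pair (gen 22) and settles every distance.

ALGEBRA (**`rayleigh_sameApex_nonneg`**, **`InKE.rayleigh_sameApex_nonneg`**; replacing the tensor-Bernstein bookkeeping of the memo by a
POINTWISE invariant cone).  **`InC q`** is the convex cone of bivectors generated by the initial bivectors `ω_u = ĥ(AC¹u) ∧ ĥ(AC⁰u)` of valid `u`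
and by the letter images `∧²M(a,b) ι κ` of the polyhedral cone `𝒦*(q)` (`…MixedCone`).  It is closed under the letters (**`InC.scaleM_mem`**:
`∧²M ω_u = ω_{Mu}`, `∧²M∧²M' = ∧²(MM')`) and under every rim step (**`InC.stepE_mem`**: `∧²E_r ω_u = r²ω_u + r(1−r)ιS(u) + (1−r)²N^{(bc)}(u)ι(−e_k)`
with `S(u), −e_k ∈ 𝒦*` — facts (II), (III); `∧²E_r∧²Mικ = r²∧²Mικ + r(1−r)ι(L_Mκ) + (1−r)²(−φ(L_Mκ)/2)ι(−e_k)` with `L_M κ ∈ 𝒦*` — fact (I),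
**`InKstar.lm`**, assembled here from the four `…MixedConeInv*` files — and `φ ≤ 0` on `𝒦*`), and the Rayleigh pairing is non-negative on it
(**`InC.pairF_nonneg`**: the parallel-spokes value on `ω_u`; self-adjointness `pairF s (∧²Mικ) = q²(1−q)·Fdot (M s) κ ≥ 0` — fact (IV)).  The
bivector of the word between the two spokes (**`midWord`**, **`sameApexZ`**) lies in `InC q` by induction (**`InC.midWord_mem`**), and
`Δ = pairF q s (bivector)` (`rayleigh_eq_pairF`).
MEASURE LEVEL.  The cut formula of `…DoubleFanNegCorr` and the block bookkeeping (**`midBlocks`**, **`zDF_eq_midWord`**, **`cut_pin_spokesA_far`**)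
express the four pinned partition functions as `sameApexZ` valuations (special cases `spokesAZ`, `sameTwoZ`: `sameApexZ_nil`, `sameApexZ_single`)
with rests in `InKE q`.  With `negCorr_spokes_at_rim`, `negCorr_axis_spokeA/B`, `negCorr_rim_spoke…`, `negCorr_rim_rim` (gens 20–21) the open pair
types of a weighted double fan are now only the cross-apex spoke pairs at different rim vertices and the far rim/spoke, rim/rim pairs.
[cite: Grimmett2006, §3.9 eq. (3.94) (pp. 63–64); §1.4 eq. (1.20) (p. 15)] [cite: Wagner2006, Conj. 5.3 (p. 13)] [folklore]
-/

noncomputable section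

namespace Summit.CriticalPhenomena.PercolationContinuityZ3.Theorems

namespace FK

namespace ThreeApex

/-! ### (I) assembled: the cone is invariant under `L_M` -/

/-- (I) **`L_M 𝒦*(q) ⊆ 𝒦*(q)`** for all `a, b ∈ [0,1]` (`0 ≤ q ≤ 1`). [folklore] -/
theorem InKstar.lm {q a b : ℝ} (hq0 : 0 ≤ q) (hq1 : q ≤ 1) (ha0 : 0 ≤ a) (ha1 : a ≤ 1) (hb0 : 0 ≤ b) (hb1 : b ≤ 1) {κ : K7}
    (hκ : InKstar q κ) : InKstar q (LM q a b κ) :=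
  ⟨hκ.lm_phi1 hq0 hq1 ha0 ha1 hb0 hb1, hκ.lm_phi2 hq0 hq1 ha0 ha1 hb0 hb1, hκ.lm_phi3 hq0 hq1 ha0 ha1 hb0 hb1, hκ.lm_phi4 hq0 hq1 ha0 ha1 hb0 hb1, hκ.lm_phi5 hq0 hq1 ha0 ha1 hb0 hb1, hκ.lm_phi6 hq0 hq1 ha0 ha1 hb0 hb1, hκ.lm_phi7 hq0 hq1 ha0 ha1 hb0 hb1, hκ.lm_phi9 hq0 hq1 ha0 ha1 hb0 hb1, hκ.lm_phi10 hq0 hq1 ha0 ha1 hb0 hb1, hκ.lm_phi11 hq0 hq1 ha0 ha1 hb0 hb1, hκ.lm_d1 hq0 hq1 ha0 ha1 hb0 hb1, hκ.lm_d2 hq0 hq1 ha0 ha1 hb0 hb1, hκ.lm_d3 hq0 hq1 ha0 ha1 hb0 hb1, hκ.lm_d4 hq0 hq1 ha0 ha1 hb0 hb1, hκ.lm_d5 hq0 hq1 ha0 ha1 hb0 hb1, hκ.lm_d18 hq0 hq1 ha0 ha1 hb0 hb1, hκ.lm_fF1 hq0 hq1 ha0 ha1 hb0 hb1, hκ.lm_fF2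 hq0 hq1 ha0 ha1 hb0 hb1, hκ.lm_fF3 hq0 hq1 ha0 ha1 hb0 hb1, hκ.lm_fF4 hq0 hq1 ha0 ha1 hb0 hb1, hκ.lm_fF6 hq0 hq1 ha0 ha1 hb0 hb1, hκ.lm_fF7 hq0 hq1 ha0 ha1 hb0 hb1, hκ.lm_fF8 hq0 hq1 ha0 ha1 hb0 hb1, hκ.lm_fF9 hq0 hq1 ha0 ha1 hb0 hb1, hκ.lm_f27 hq0 hq1 ha0 ha1 hb0 hb1⟩

/-! ### The inductive cone of bivector states -/

/-- **The cone of states.**  Generated by the initial bivectors `ω_u` of valid `u` and the letter images `∧²M(a,b) ι κ`, `κ ∈ 𝒦*(q)`,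
`a, b ∈ [0,1]`; closed under sums and non-negative multiples. [folklore] -/
inductive InC (q : ℝ) : B10 → Prop
  | omega {u : V5} : Valid q u → InC q (wedgeV (conv (edgeAC 1) u) (conv (edgeAC 0) u))
  | cone {a b : ℝ} {κ : K7} : 0 ≤ a → a ≤ 1 → 0 ≤ b → b ≤ 1 → InKstar q κ → InC q (scaleM a b (iota κ))
  | add {β γ : B10} : InC q β → InC q γ → InC q (β + γ)
  | smul {c : ℝ} {β : B10} : 0 ≤ c → InC q β → InC q (c • β)

/-- Letters with complementary weights `a, b ∈ [0,1]` keep validity. [folklore] -/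
theorem valid_letters {q a b : ℝ} (hq0 : 0 ≤ q) (hq1 : q ≤ 1) (ha0 : 0 ≤ a) (ha1 : a ≤ 1) (hb0 : 0 ≤ b) (hb1 : b ≤ 1) {u : V5}
    (hu : Valid q u) : Valid q (conv (edgeAC (1 - a)) (conv (edgeBC (1 - b)) u)) :=
  ((IsLetter.ac (sub_nonneg.2 ha1) (by linarith)).valid hq0 hq1).conv hq0
    (((IsLetter.bc (sub_nonneg.2 hb1) (by linarith)).valid hq0 hq1).conv hq0 hu)

/-- **Closure under letters**: `∧²M(a,b)` maps the cone into itself (`a, b ∈ [0,1]`, `0 ≤ q ≤ 1`). [folklore] -/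
theorem InC.scaleM_mem {q a b : ℝ} (hq0 : 0 ≤ q) (hq1 : q ≤ 1) (ha0 : 0 ≤ a) (ha1 : a ≤ 1) (hb0 : 0 ≤ b) (hb1 : b ≤ 1) {β : B10}
    (h : InC q β) : InC q (scaleM a b β) := by
  induction h with
  | @omega u hu =>
    have h := InC.omega (valid_letters hq0 hq1 ha0 ha1 hb0 hb1 hu)
    rw [← scaleM_omega, sub_sub_cancel, sub_sub_cancel] at h
    exact h
  | cone ha0' ha1' hb0' hb1' hκ =>
    rw [scaleM_scaleM]
    exact InC.cone (mul_nonneg ha0 ha0') (mul_le_one₀ ha1 ha0' ha1') (mul_nonneg hb0 hb0') (mul_le_one₀ hb1 hb0' hb1') hκ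
  | add _ _ ih1 ih2 => rw [scaleM_add]; exact InC.add ih1 ih2
  | smul hc _ ih => rw [scaleM_smul]; exact InC.smul hc ih

/-- **Closure under rim steps**: `∧²E_r` maps the cone into itself (`r ∈ [0,1]`, `0 ≤ q ≤ 1`) — this is where the four cone facts enter:
(II) `S(u) ∈ 𝒦*`, (III) `−e_k ∈ 𝒦*`, (I) `L_M 𝒦* ⊆ 𝒦*`, and the facet `−φ ≥ 0`. [folklore] -/
theorem InC.stepE_mem {q r : ℝ} (hq0 : 0 ≤ q) (hq1 : q ≤ 1) (hr0 : 0 ≤ r) (hr1 : r ≤ 1) {β : B10} (h : InC q β) :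
    InC q (stepE q r β) := by
  have hr' : 0 ≤ 1 - r := sub_nonneg.2 hr1
  induction h with
  | @omega u hu =>
    rw [stepE_omega]
    have hN : 0 ≤ masterN q (swapAB u) := hu.nBC
    exact InC.add (InC.add (InC.smul (by positivity) (InC.omega hu))
      (InC.smul (by positivity) (InC.cone zero_le_one le_rfl zero_le_one le_rfl (svec_inKstar hq0 hq1 hu))))
      (InC.smul (by positivity) (InC.cone zero_le_one le_rfl zero_le_one le_rfl (inKstar_negAxis hq0 hq1)))
  | @cone a b κ ha0 ha1 hb0 hb1 hκ =>
    rw [stepE_scaleM_iota]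
    have hL : InKstar q (LM q a b κ) := hκ.lm hq0 hq1 ha0 ha1 hb0 hb1
    have hφ : 0 ≤ -phiK q (LM q a b κ) / 2 := by
      have := hL.phi11; simp only [phiK]; linarith
    exact InC.add (InC.add (InC.smul (by positivity) (InC.cone ha0 ha1 hb0 hb1 hκ))
      (InC.smul (by positivity) (InC.cone zero_le_one le_rfl zero_le_one le_rfl hL)))
      (InC.smul (by positivity) (InC.cone zero_le_one le_rfl zero_le_one le_rfl (inKstar_negAxis hq0 hq1)))
  | add _ _ ih1 ih2 => rw [stepE_add]; exact InC.add ih1 ih2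
  | smul hc _ ih => rw [stepE_smul]; exact InC.smul hc ih

/-- **The Rayleigh pairing is non-negative on the cone** for every valid `s` (`0 ≤ q ≤ 1`): the parallel-spokes value on `ω_u`, and — by the
self-adjointness of the letters — `q²(1−q)·Fdot` at the lettered `s` on the generators from `𝒦*` (fact (IV)). [folklore] -/
theorem InC.pairF_nonneg {q : ℝ} (hq0 : 0 ≤ q) (hq1 : q ≤ 1) {s : V5} (hs : Valid q s) {β : B10} (h : InC q β) : 0 ≤ pairF q s β := by
  induction h with
  | @omega u hu => exact pairF_omega_nonneg hq0 hq1 hu.nonneg hs.nonneg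
  | @cone a b κ ha0 ha1 hb0 hb1 hκ =>
    have hs' := valid_letters hq0 hq1 ha0 ha1 hb0 hb1 hs
    have e := pairF_scaleM q (1 - a) (1 - b) s (iota κ)
    rw [sub_sub_cancel, sub_sub_cancel, pairF_iota] at e
    rw [e]
    rcases lt_or_eq_of_le hq0 with h0 | h0
    · rcases lt_or_eq_of_le hq1 with h1 | h1
      · exact mul_nonneg (mul_nonneg (pow_nonneg hq0 2) (sub_nonneg.2 hq1)) (fdot_nonneg_of_valid h0 h1 hs' hκ)
      · rw [h1]; simp
    · rw [← h0]; simp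
  | add _ _ ih1 ih2 => rw [pairF_add]; exact add_nonneg ih1 ih2
  | smul hc _ ih => rw [pairF_smul]; exact mul_nonneg hc ih

/-! ### The word between two spokes of the same apex and the main inequality -/

/-- The blocks between the two spokes, applied to a vector: each entry `(r, x, y)` is the rim edge into a new rim vertex (probability `r`)
followed by its two spokes `AC(x) BC(y)`. [folklore] -/
def midWord (q : ℝ) : List (ℝ × ℝ × ℝ) → V5 → V5
  | [], X => X
  | blk :: rest, X => midWord q rest (conv (edgeAC blk.2.1) (conv (edgeBC blk.2.2) (rimStep q blk.1 X)))

/-- All weights of the blocks lie in `[0,1]`. [folklore] -/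
def UnitBlocks (l : List (ℝ × ℝ × ℝ)) : Prop :=
  ∀ blk ∈ l, 0 ≤ blk.1 ∧ blk.1 ≤ 1 ∧ 0 ≤ blk.2.1 ∧ blk.2.1 ≤ 1 ∧ 0 ≤ blk.2.2 ∧ blk.2.2 ≤ 1

/-- **The pinned partition function of two spokes of the same apex at any distance**:
`Z^{αβ} = val_q(s ∗ AC^β ∗ E_{r_d} ∗ [AC(x_{d-1})BC(y_{d-1})E_{r_{d-1}}] ⋯ [AC(x_1)BC(y_1)E_{r_1}] ∗ AC^α u)`. [folklore] -/
def sameApexZ (q : ℝ) (mids : List (ℝ × ℝ × ℝ)) (rd : ℝ) (u s : V5) (α β : ℝ) : ℝ :=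
  val q (conv s (conv (edgeAC β) (rimStep q rd (midWord q mids (conv (edgeAC α) u)))))

/-- **The bivector of the word stays in the cone** (induction along the blocks). [folklore] -/
theorem InC.midWord_mem {q : ℝ} (hq0 : 0 ≤ q) (hq1 : q ≤ 1) :
    ∀ (mids : List (ℝ × ℝ × ℝ)), UnitBlocks mids → ∀ {Y1 Y0 : V5}, InC q (wedgeV Y1 Y0) →
      InC q (wedgeV (midWord q mids Y1) (midWord q mids Y0)) := by
  intro mids
  induction mids with
  | nil => intro _ Y1 Y0 h; exact h
  | cons blk rest ih =>
    intro hl Y1 Y0 h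
    obtain ⟨hr0, hr1, hx0, hx1, hy0, hy1⟩ := hl blk (List.mem_cons_self)
    have hrest : UnitBlocks rest := fun b hb => hl b (List.mem_cons_of_mem _ hb)
    show InC q (wedgeV (midWord q rest _) (midWord q rest _))
    refine ih hrest ?_
    rw [wedgeV_letters, wedgeV_rimStep]
    exact (h.stepE_mem hq0 hq1 hr0 hr1).scaleM_mem hq0 hq1 (sub_nonneg.2 hx1) (by linarith) (sub_nonneg.2 hy1) (by linarith)

/-- **ALL SAME-APEX SPOKE PAIRS: the Rayleigh difference is `≥ 0`** for valid `u, s`, `0 ≤ q ≤ 1`, every list of middle blocks with weights in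
`[0,1]` and every last rim weight `r_d ∈ [0,1]`. [folklore] -/
theorem rayleigh_sameApex_nonneg {q rd : ℝ} (hq0 : 0 ≤ q) (hq1 : q ≤ 1) {mids : List (ℝ × ℝ × ℝ)} (hmids : UnitBlocks mids)
    (hrd0 : 0 ≤ rd) (hrd1 : rd ≤ 1) {u s : V5} (hu : Valid q u) (hs : Valid q s) :
    0 ≤ sameApexZ q mids rd u s 1 0 * sameApexZ q mids rd u s 0 1 - sameApexZ q mids rd u s 1 1 * sameApexZ q mids rd u s 0 0 := by
  simp only [sameApexZ]
  rw [rayleigh_eq_pairF, wedgeV_rimStep]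
  exact ((InC.midWord_mem hq0 hq1 mids hmids (InC.omega hu)).stepE_mem hq0 hq1 hrd0 hrd1).pairF_nonneg hq0 hq1 hs

/-- The same for rests in the rim-step closure `InKE q` (prefix / reversed suffix of a double fan with hung three-apex words). [folklore] -/
theorem InKE.rayleigh_sameApex_nonneg {q rd : ℝ} (hq0 : 0 ≤ q) (hq1 : q ≤ 1) {mids : List (ℝ × ℝ × ℝ)} (hmids : UnitBlocks mids)
    (hrd0 : 0 ≤ rd) (hrd1 : rd ≤ 1) {u s : V5} (hu : InKE q u) (hs : InKE q s) :
    0 ≤ sameApexZ q mids rd u s 1 0 * sameApexZ q mids rd u s 0 1 - sameApexZ q mids rd u s 1 1 * sameApexZ q mids rd u s 0 0 :=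
  ThreeApex.rayleigh_sameApex_nonneg hq0 hq1 hmids hrd0 hrd1 (hu.valid hq0 hq1) (hs.valid hq0 hq1)


open MeasureTheory Literature.Probability.LatticeModels Literature.Probability.Percolation
open scoped Classical

/-! ### Special cases of the general word -/

/-- With no middle vertex the general word is the adjacent pair of `…SpokesAdjacent`. [folklore] -/
theorem sameApexZ_nil (q rd : ℝ) (u s : V5) (α β : ℝ) : sameApexZ q [] rd u s α β = spokesAZ q rd u s α β := rfl

/-- With one middle vertex the general word is the distance-two pair of `…SameTwoA`. [folklore] -/
theorem sameApexZ_single (q r x y rd : ℝ) (u s : V5) (α β : ℝ) :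
    sameApexZ q [(r, x, y)] rd u s α β = sameTwoZ q x y r rd u s α β := rfl

/-- Appending a block to the middle word. [folklore] -/
theorem midWord_append (q : ℝ) (l : List (ℝ × ℝ × ℝ)) (blk : ℝ × ℝ × ℝ) (X : V5) :
    midWord q (l ++ [blk]) X = conv (edgeAC blk.2.1) (conv (edgeBC blk.2.2) (rimStep q blk.1 (midWord q l X))) := by
  induction l generalizing X with
  | nil => rfl
  | cons b rest ih => exact ih _

variable {V : Type*} [Fintype V]

/-! ### The middle blocks of a double fan read off the weights -/

/-- The blocks `j+1, …, j+n` of the transfer word as a list of `(rim weight, a-spoke weight, b-spoke weight)`. [folklore] -/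
def midBlocks (w : Sym2 V → unitInterval) (a b : V) (c : ℕ → V) (j : ℕ) : ℕ → List (ℝ × ℝ × ℝ)
  | 0 => []
  | n + 1 => midBlocks w a b c j n ++ [(wR w s(c (j + n), c (j + n + 1)), wR w s(a, c (j + n + 1)), wR w s(b, c (j + n + 1)))]

omit [Fintype V] in
/-- **The word splits into blocks**: `Z_{j+n} = midWord (midBlocks j n) Z_j`. [folklore] -/
theorem zDF_eq_midWord (q : ℝ) (w : Sym2 V → unitInterval) (a b : V) (c : ℕ → V) (j : ℕ) :
    ∀ n, zDF q w a b c (j + n) = midWord q (midBlocks w a b c j n) (zDF q w a b c j)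
  | 0 => rfl
  | n + 1 => by
    rw [midBlocks, midWord_append, ← zDF_eq_midWord q w a b c j n]
    rfl

omit [Fintype V] in
/-- All block weights lie in `[0,1]`. [folklore] -/
theorem unitBlocks_midBlocks (w : Sym2 V → unitInterval) (a b : V) (c : ℕ → V) (j : ℕ) : ∀ n, UnitBlocks (midBlocks w a b c j n)
  | 0 => by intro blk h; simp [midBlocks] at h
  | n + 1 => by
    intro blk h
    rw [midBlocks, List.mem_append, List.mem_singleton] at h
    rcases h with h | rfl
    · exact unitBlocks_midBlocks w a b c j n blk h
    · exact ⟨(w _).2.1, (w _).2.2, (w _).2.1, (w _).2.2, (w _).2.1, (w _).2.2⟩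

omit [Fintype V] in
/-- The middle blocks do not read a pair that no block `j+1, …, j+n` reads. [folklore] -/
theorem midBlocks_update_eq (w : Sym2 V → unitInterval) {a b : V} {c : ℕ → V} {e : Sym2 V} (t : unitInterval) (j : ℕ) :
    ∀ n, (∀ k, j < k → k ≤ j + n → ¬ ReadsAt a b c k e) → midBlocks (Function.update w e t) a b c j n = midBlocks w a b c j n
  | 0 => fun _ => rfl
  | n + 1 => fun h => by
    have hr := h (j + n + 1) (by omega) (by omega)
    have h1 : e ≠ s(a, c (j + n + 1)) := fun h' => hr (Or.inl h')
    have h2 : e ≠ s(b, c (j + n + 1)) := fun h' => hr (Or.inr (Or.inl h'))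
    have h4 : e ≠ s(c (j + n), c (j + n + 1)) := fun h' => hr (Or.inr (Or.inr (Or.inr ⟨j + n, rfl, h'⟩)))
    rw [midBlocks, midBlocks, midBlocks_update_eq w t j n (fun k hk hk' => h k hk (by omega)), wR_update_of_ne w (Ne.symm h1),
      wR_update_of_ne w (Ne.symm h2), wR_update_of_ne w (Ne.symm h4)]

section Setting

variable {a b : V} {c : ℕ → V} {m : ℕ}
variable (hab : a ≠ b) (hinj : ∀ j k, j ≤ m → k ≤ m → c j = c k → j = k) (hca : ∀ j, j ≤ m → c j ≠ a) (hcb : ∀ j, j ≤ m → c j ≠ b)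
include hab hinj hca hcb

omit [Fintype V] in
/-- **The word with the `a`-spokes of `c j` and `c (j+d+1)` pinned** (`d` middle vertices), through the cut at block `j+d+1`: the four partition
functions are the `sameApexZ` valuations with `u = edgeBC(w_{b c_j}) · (input of block j)`, the middle blocks read off `w`, the last rim weight
`w_{c_{j+d} c_{j+d+1}}`, and `s = (reversed suffix) · edgeBC(w_{b c_{j+d+1}})`. [folklore] -/
theorem cut_pin_spokesA_far (q : ℝ) (w : Sym2 V → unitInterval) {j d : ℕ} (hjd : j + d + 1 ≤ m) (α β : unitInterval) :
    transferDF q (Function.update (Function.update w s(a, c j) α) s(a, c (j + d + 1)) β) a b c m =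
      sameApexZ q (midBlocks w a b c j d) (wR w s(c (j + d), c (j + d + 1)))
        (conv (edgeBC (wR w s(b, c j))) (blockIn q w a b c j))
        (conv (restVec q w a b c (j + d + 1) (m - (j + d + 1))) (edgeBC (wR w s(b, c (j + d + 1))))) (α : ℝ) (β : ℝ) := by
  set w₁ := Function.update w s(a, c j) α with hw₁
  set w₂ := Function.update w₁ s(a, c (j + d + 1)) β with hw₂
  have hj0 : j ≤ m := by omega
  have hlater1 : ∀ k, j + d + 1 < k → k ≤ m → ¬ ReadsAt a b c k s(a, c j) := fun k hk hkm hr =>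
    absurd ((readsAt_spokeA_iff hab hinj hca hcb hj0 hkm).1 hr) (by omega)
  have hlater2 : ∀ k, j + d + 1 < k → k ≤ m → ¬ ReadsAt a b c k s(a, c (j + d + 1)) := fun k hk hkm hr =>
    absurd ((readsAt_spokeA_iff hab hinj hca hcb hjd hkm).1 hr) (by omega)
  have hmid1 : ∀ k, j < k → k ≤ j + d → ¬ ReadsAt a b c k s(a, c j) := fun k hk hkm hr =>
    absurd ((readsAt_spokeA_iff hab hinj hca hcb hj0 (by omega)).1 hr) (by omega)
  have hmid2 : ∀ k, j < k → k ≤ j + d → ¬ ReadsAt a b c k s(a, c (j + d + 1)) := fun k hk hkm hr =>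
    absurd ((readsAt_spokeA_iff hab hinj hca hcb hjd (by omega)).1 hr) (by omega)
  have hrest : restVec q w₂ a b c (j + d + 1) (m - (j + d + 1)) = restVec q w a b c (j + d + 1) (m - (j + d + 1)) := by
    rw [hw₂, restVec_update_eq q w₁ β (m - (j + d + 1)) (j + d + 1) (by omega) hlater2, hw₁,
      restVec_update_eq q w α (m - (j + d + 1)) (j + d + 1) (by omega) hlater1]
  have hmid : midBlocks w₂ a b c j d = midBlocks w a b c j d := by
    rw [hw₂, midBlocks_update_eq w₁ β j d hmid2, hw₁, midBlocks_update_eq w α j d hmid1]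
  have hin : blockIn q w₂ a b c j = blockIn q w a b c j := by
    rw [hw₂, blockIn_update_eq q w₁ β (fun k hk hr => absurd ((readsAt_spokeA_iff hab hinj hca hcb hjd (by omega)).1 hr) (by omega))
      (spokeA_ne_axis hab hcb hjd) (fun i hi => spokeA_ne_rim hca (j := j + d + 1) (by omega)),
      hw₁, blockIn_update_eq q w α (fun k hk hr => absurd ((readsAt_spokeA_iff hab hinj hca hcb hj0 (by omega)).1 hr) (by omega))
      (spokeA_ne_axis hab hcb hj0) (fun i hi => hi ▸ spokeA_ne_rim hca (j := i + 1) (hi ▸ hj0))]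
  have hα : wR w₂ s(a, c j) = (α : ℝ) := by
    rw [hw₂, wR_update_of_ne w₁ (spokeA_ne_spokeA hinj hj0 hjd (by omega)), hw₁, wR_update_self]
  have hβ : wR w₂ s(a, c (j + d + 1)) = (β : ℝ) := by rw [hw₂, wR_update_self]
  have hyj : wR w₂ s(b, c j) = wR w s(b, c j) := by
    rw [hw₂, wR_update_of_ne w₁ (spokeA_ne_spokeB hab hca hj0).symm, hw₁, wR_update_of_ne w (spokeA_ne_spokeB hab hca hj0).symm]
  have hyD : wR w₂ s(b, c (j + d + 1)) = wR w s(b, c (j + d + 1)) := by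
    rw [hw₂, wR_update_of_ne w₁ (spokeA_ne_spokeB hab hca hjd).symm, hw₁, wR_update_of_ne w (spokeA_ne_spokeB hab hca hjd).symm]
  have hr : wR w₂ s(c (j + d), c (j + d + 1)) = wR w s(c (j + d), c (j + d + 1)) := by
    rw [hw₂, wR_update_of_ne w₁ (spokeA_ne_rim hca (j := j + d + 1) hjd).symm, hw₁,
      wR_update_of_ne w (spokeA_ne_rim hca (j := j) hjd).symm]
  rw [transferDF_eq_cut q w₂ a b c hjd, zDF_eq_block, hrest, blockIn_succ, zDF_eq_midWord q w₂ a b c j d, zDF_eq_block q w₂ a b c j,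
    hmid, hin, hα, hβ, hyj, hyD, hr]
  -- reassociate: R ∗ (AC β ∗ (BC y ∗ W)) = (R ∗ BC y) ∗ (AC β ∗ W)
  simp only [sameApexZ, ← mul_def]
  rw [mul_left_comm (edgeAC (β : ℝ)) (edgeBC _), ← mul_assoc (restVec q w a b c (j + d + 1) (m - (j + d + 1)))]

/-- **Two `a`-spokes `d + 1` rim vertices apart are negatively correlated** in every weighted double fan (`0 < q ≤ 1`, `card V = m + 3`, `w`
supported on the double fan, `j + d + 1 ≤ m`): `φ(J_{a c_j} ∩ J_{a c_{j+d+1}}) ≤ φ(J_{a c_j}) φ(J_{a c_{j+d+1}})`. [cite: Grimmett2006, §3.9 eq. (3.94) (pp. 63–64)] -/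
theorem negCorr_spokesA_far (hcard : Fintype.card V = m + 3) {q : ℝ} (hq0 : 0 < q) (hq1 : q ≤ 1) (w : Sym2 V → unitInterval)
    (hsupp : ∀ e, e ∉ dfPairs a b c m → w e = 0) {j d : ℕ} (hjd : j + d + 1 ≤ m) :
    (rcMeasureW w q ∅).real ({ω : BondConfig V | s(a, c j) ∈ ω} ∩ {ω | s(a, c (j + d + 1)) ∈ ω}) ≤
      (rcMeasureW w q ∅).real {ω : BondConfig V | s(a, c j) ∈ ω} *
        (rcMeasureW w q ∅).real {ω : BondConfig V | s(a, c (j + d + 1)) ∈ ω} := by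
  have hj0 : j ≤ m := by omega
  have he : s(a, c j) ∈ dfPairs a b c m := (mem_dfPairs_iff a b c m _).2 (Or.inr (Or.inl ⟨j, hj0, Or.inl rfl⟩))
  have hf : s(a, c (j + d + 1)) ∈ dfPairs a b c m := (mem_dfPairs_iff a b c m _).2 (Or.inr (Or.inl ⟨j + d + 1, hjd, Or.inl rfl⟩))
  have hne : s(a, c (j + d + 1)) ≠ s(a, c j) := spokeA_ne_spokeA hinj hjd hj0 (by omega)
  set u := conv (edgeBC (wR w s(b, c j))) (blockIn q w a b c j) with hu
  set s := conv (restVec q w a b c (j + d + 1) (m - (j + d + 1))) (edgeBC (wR w s(b, c (j + d + 1)))) with hs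
  have hZ : ∀ α β : unitInterval, rcPartitionFunctionW (Function.update (Function.update w s(a, c j) α) s(a, c (j + d + 1)) β) q ∅ =
      sameApexZ q (midBlocks w a b c j d) (wR w s(c (j + d), c (j + d + 1))) u s (α : ℝ) (β : ℝ) := by
    intro α β
    rw [rcPartitionFunctionW_eq_transferDF hab hinj hca hcb hcard q _
      (supp_update_dfPair _ (supp_update_dfPair w hsupp he α) hf β), cut_pin_spokesA_far hab hinj hca hcb q w hjd α β]
  have huK : InKE q u := InKE.step (IsLetter.bc (w _).2.1 (w _).2.2) (inKE_blockIn q w a b c j)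
  have hsK : InKE q s := InKE.mul (inKE_restVec q w a b c (m - (j + d + 1)) (j + d + 1)) (by
    rw [← mul_one (edgeBC (wR w s(b, c (j + d + 1)))), mul_def, one_def]
    exact InKE.step (IsLetter.bc (w _).2.1 (w _).2.2) InKE.base)
  have key := InKE.rayleigh_sameApex_nonneg (rd := wR w s(c (j + d), c (j + d + 1))) hq0.le hq1 (unitBlocks_midBlocks w a b c j d)
    (w _).2.1 (w _).2.2 huK hsK
  refine negCorr_of_pinned_rayleigh w hq0 hne ?_
  rw [hZ 1 1, hZ 0 0, hZ 1 0, hZ 0 1]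
  simp only [Set.Icc.coe_one, Set.Icc.coe_zero]
  linarith [key]

/-- **ANY TWO SPOKES OF THE APEX `a` ARE NEGATIVELY CORRELATED** (`i < k ≤ m`; `0 < q ≤ 1`; `w` supported on the double fan):
`φ_{w,q}(J_{a c_i} ∩ J_{a c_k}) ≤ φ_{w,q}(J_{a c_i})·φ_{w,q}(J_{a c_k})`. [cite: Grimmett2006, §3.9 eq. (3.94) (pp. 63–64)] -/
theorem negCorr_spokesA_sameApex (hcard : Fintype.card V = m + 3) {q : ℝ} (hq0 : 0 < q) (hq1 : q ≤ 1) (w : Sym2 V → unitInterval)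
    (hsupp : ∀ e, e ∉ dfPairs a b c m → w e = 0) {i k : ℕ} (hik : i < k) (hk : k ≤ m) :
    (rcMeasureW w q ∅).real ({ω : BondConfig V | s(a, c i) ∈ ω} ∩ {ω | s(a, c k) ∈ ω}) ≤
      (rcMeasureW w q ∅).real {ω : BondConfig V | s(a, c i) ∈ ω} * (rcMeasureW w q ∅).real {ω : BondConfig V | s(a, c k) ∈ ω} := by
  obtain ⟨d, rfl⟩ := Nat.exists_eq_add_of_lt hik
  exact negCorr_spokesA_far hab hinj hca hcb hcard hq0 hq1 w hsupp hk

/-- **Any two spokes of the apex `b` are negatively correlated** (the `a ↔ b` relabelling). [cite: Grimmett2006, §3.9 eq. (3.94) (pp. 63–64)] -/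
theorem negCorr_spokesB_sameApex (hcard : Fintype.card V = m + 3) {q : ℝ} (hq0 : 0 < q) (hq1 : q ≤ 1) (w : Sym2 V → unitInterval)
    (hsupp : ∀ e, e ∉ dfPairs a b c m → w e = 0) {i k : ℕ} (hik : i < k) (hk : k ≤ m) :
    (rcMeasureW w q ∅).real ({ω : BondConfig V | s(b, c i) ∈ ω} ∩ {ω | s(b, c k) ∈ ω}) ≤
      (rcMeasureW w q ∅).real {ω : BondConfig V | s(b, c i) ∈ ω} * (rcMeasureW w q ∅).real {ω : BondConfig V | s(b, c k) ∈ ω} :=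
  negCorr_spokesA_sameApex hab.symm hinj hcb hca hcard hq0 hq1 w (fun e he => hsupp e (by rwa [dfPairs_swap] at he)) hik hk

end Setting

end ThreeApex

end FK

end Summit.CriticalPhenomena.PercolationContinuityZ3.Theorems
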